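import Literature.MathematicalPhysics.QuantumFieldTheory.Dimock2011to13.HoleSummability

/-!
# Dimock, *The renormalization group according to Balaban* III, App. B "a resummation operation": the map `X → Y`
# (adjoin the components of the new holes), `B′(Y) = Σ_{X→Y} B(X)`, the regrouping identity, and LEMMA 19 (diamond)
# `|B′(Y)| ≤ 𝒪(1) B₀ e^{−(κ−κ₀−1) d_M(Y, mod Λᶜ)}` — PROVED on the cell's torus polymer model, every `d`, `N`

**Citation header (reproduction of PUBLISHED work; template of the Balaban lattice Yang–Mills cell).**
J. Dimock, *The renormalization group according to Balaban. III. Convergence*, Ann. Henri Poincaré **15** (2014)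
2133–2175 (= arXiv:1304.0705v1) [Dimock2013BalabanIII], Appendix B "a resummation operation" (`\label{B}`, TeX
L2603–2659 of the arXiv source held by the cell, `inputs/files/dimock/src/1304.0705/1304.0705.tex`, sha256[:16]
dfd556282834aeba, 2836 lines): the setup L2605–2624, LEMMA 19 (`\label{diamond}`, eq. (opal), L2627–2631; the 19th
`\begin{lem}` under `\newtheorem{lem}{Lemma}` L16 — Lemma 18 = App. A L2551, Lemma 20 = App. C (sylvan1) L2670) and its
proof L2635–2659, which invokes [Dimock2013BalabanII] (arXiv:1212.5562v2) App. E Lemma E.3 (TeX L6914–6920).  The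
appendix is used at [Dimock2013BalabanIII] §2.8 (slinky) L1362–1374 (*"See appendix B for details on this step"*: the
decay rate `κ − 6κ₀ − 6` becomes `κ − 7κ₀ − 7`) and the same move appears in [Dimock2013BalabanII] §3.13 L4934 and §3.18
L6122, L6330, L6356.  Dimock's papers are published and refereed and are the cell's TEMPLATE, not manuscripts
under audit; no quantity of the Bałaban series is touched.

**What the paper prints (verbatim).**  L2605–2624: *"Suppose Ω, Λ are unions of M cubes with Λ ⊂ Ω, and we have an
expression Σ_{X ∈ 𝒟_k(mod Ωᶜ), X ∩ Λ ≠ ∅} B(X) with |B(X)| ≤ B₀ e^{−κ d_M(X, mod Ωᶜ)} for some constant B₀. We want to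
write it as a similar sum with Ω replaced Λ everywhere. Every such X determines a Y ∈ 𝒟_k(mod Λᶜ) with Y ∩ Λ ≠ ∅ by
taking the union with any connected component of Λᶜ connected to X, written X → Y. We define B′(Y) = Σ_{X ∈ 𝒟_k(mod
Ωᶜ), X ∩ Λ ≠ ∅, X → Y} B(X) and then Σ_{X ∈ 𝒟_k(mod Ωᶜ), X ∩ Λ ≠ ∅} B(X) = Σ_{Y ∈ 𝒟_k(mod Λᶜ), Y ∩ Λ ≠ ∅} B′(Y)"*.
**Lemma 19** (L2627–2631): *"|B′(Y)| ≤ 𝒪(1) B₀ e^{−(κ−κ₀−1) d_M(Y, mod Λᶜ)}"* (opal).  Proof (L2635–2659): *"We first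
claim that d_M(Y, mod Λᶜ) ≤ d_M(X, mod Ωᶜ). Indeed let τ be a minimal tree joining the cubes in X ∩ Ω of length ℓ(τ) =
M d_M(X). Then τ is also a tree joining the cubes in Y ∩ Λ since Y ∩ Λ = X ∩ Λ ⊂ X ∩ Ω. Hence M d_M(Y, mod Λᶜ) ≤ ℓ(τ)
and hence the result. Then we have |B′(Y)| ≤ Σ_{X ∈ 𝒟_k(mod Λᶜ)* ⟦sic: Ωᶜ⟧ *, X ∩ (Y ∩ Λ) ≠ ∅} B₀ e^{−κ d_M(X, mod
Ωᶜ)} ≤ B₀ e^{−(κ−κ₀) d_M(Y, mod Λᶜ)} Σ_{X ∈ 𝒟_k(mod Ωᶜ), X ∩ (Y ∩ Λ) ≠ ∅} e^{−κ₀ d_M(X, mod Ωᶜ)} ≤ 𝒪(1) B₀ e^{−(κ−κ₀)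
d_M(Y, mod Λᶜ)} |Y ∩ Λ|_M  (topaz)  Since Y ∩ Λ ⊂ Ω the last step follows by lemma E.3 in part II. The result now
follows by |Y ∩ Λ|_M ≤ 𝒪(1)(d_M(Y ∩ Λ) + 1) = 𝒪(1)(d_M(Y, mod Λᶜ) + 1) ≤ 𝒪(1) e^{d_M(Y, mod Λᶜ)}"*.

**What is reproduced here (kernel-checked; Mathlib + the imported cell modules only).**  CARRIER = the cell's torus
polymer model: the `M`-cubes of the torus are the points `TPt d N = (ℤ/N)^d` of unit pv22's `…Balaban1983to89.TreeLengthTorus`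
(wall adjacency `TAdj`, localization domains = non-empty `TFaceConnected` families), `𝒟_k(mod Θ)` is this lineage's
component-free `ThreeSorted.DMod Θ` and `d_M(X, mod Θ)` its `ThreeSorted.torusTreeLenMod X Θ` (`…ThreeSortedResummation`),
and the holes are `Θ₀ := Ωᶜ ⊆ Θ := Λᶜ` (so `X ∩ Λ ≠ ∅` reads `(X ∖ Θ).Nonempty`; the literal `Ω ⊇ Λ` form with
complements is Part 5).  PROVED:
* Part 1 — **THE MAP `X → Y`**: `adjoin Θ X = X ∪ ⋃{wall-components of Θ met by X}` (the components being
  `HoleSummability.compSet Θ X`, i.e. `rcomponent TAdj Θ a`, `a ∈ X ∩ Θ`); `X ⊆ adjoin Θ X ⊆ X ∪ Θ`, `adjoin Θ X ∖ Θ =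
  X ∖ Θ` (the printed *"Y ∩ Λ = X ∩ Λ"*), `adjoin Θ X ∈ 𝒟_k(mod Θ)` (`dMod_adjoin`) and `adjoin Θ X` is a localization
  domain when `X` is (`tFaceConnected_adjoin`) — the printed *"Every such X determines a Y ∈ 𝒟_k(mod Λᶜ) with Y ∩ Λ ≠
  ∅"*; moreover `adjoin Θ X = X` when already `X ∈ 𝒟_k(mod Θ)` (`adjoin_eq_self_of_dMod`), so `X → Y` is a retraction.
* Part 2 — **THE FIRST CLAIM** (L2636–2642) `d_M(Y, mod Λᶜ) ≤ d_M(X, mod Ωᶜ)` (`torusTreeLenMod_le_of_subset`,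
  `torusTreeLenMod_adjoin_le`): a graph in `π⁻¹(X)` meeting every cube of `X ∖ Θ₀` lies in `π⁻¹(Y)` and meets every cube
  of `Y ∖ Θ = X ∖ Θ ⊆ X ∖ Θ₀` — for ANY `Y` with `X ⊆ Y`, `Y ∖ Θ ⊆ X` and `Θ₀ ⊆ Θ`.
* Part 3 — **THE VOLUME STEP** (L2657–2659) `|Y ∩ Λ|_M ≤ 2^d(4 d_M(Y, mod Λᶜ) + 1) ≤ 2^{d+2} e^{d_M(Y, mod Λᶜ)}`
  (`card_le_of_tCover_len`, `card_sdiff_le_torusTreeLenMod`, `card_sdiff_le_exp`): the mechanism of [Dimock2013BalabanII]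
  Lemma E.1 (3) (pv22's `TreeLength.card_le_of_sAdmissible_len`: a connected polygonal graph of length `ℓ` meets at most
  `2^d(4ℓ + 1)` unit cubes) applied to one met lift of each cube of `Y ∖ Θ`.
* Part 4 — **THE RESUMMATION AND LEMMA 19** for an arbitrary finite family `𝒜` of polymers `X ∈ 𝒟_k(mod Θ₀)` with `X ∖ Θ
  ≠ ∅` and an arbitrary map `φ` with `X ⊆ φ X`, `φ X ∖ Θ ⊆ X` (of which `adjoin Θ` is one): `Bprime 𝒜 φ B Y = Σ_{X ∈ 𝒜, φ X
  = Y} B(X)`, the regrouping identity `Σ_{X∈𝒜} B(X) = Σ_{Y∈ℬ} B′(Y)` for any `ℬ ⊇ φ(𝒜)` (`sum_eq_sum_Bprime`), and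
  **(opal)** `abs_Bprime_le`: `|B′(Y)| ≤ 2^{d+2} K₁(d) B₀ e^{−(κ−κ₀−1) d_M(Y, mod Θ)}` for EVERY `Y`, given `|B(X)| ≤ B₀
  e^{−κ d_M(X, mod Θ₀)}` on `𝒜`, `B₀ ≥ 0`, `κ₁(d) ≤ κ₀ ≤ κ`, `Θ₀ ⊆ Θ` — by the printed chain (topaz): termwise `e^{−κ d(X)} ≤
  e^{−(κ−κ₀) d(Y)} e^{−κ₀ d(X)}` (Part 2), the fibre of `Y` is covered by the families `{X ∈ 𝒜 : X ∋ □}`, `□ ∈ Y ∖ Θ`, each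
  summing to `≤ K₁(d)` by LEMMA E.3 = `HoleSummability.sum_exp_torusTreeLenMod_le` (*"Since Y ∩ Λ ⊂ Ω"*: `□ ∉ Θ ⊇ Θ₀`),
  and Part 3.
* Part 5 — **THE PRINTED FORM**: with `Ω ⊇ Λ` families of cubes of the torus, the index sets `polymersMod Ω Λ = {X ∈
  𝒟_k(mod Ωᶜ) : X ∩ Λ ≠ ∅}` (all of them, `Fintype`), `adjoin Λᶜ` maps it into `polymersMod Λ Λ = {Y ∈ 𝒟_k(mod Λᶜ) : Y ∩
  Λ ≠ ∅}` (`adjoin_mem_polymersMod`), the identity L2622–2624 (`resummation_eq`) and **LEMMA 19** (`lemma19`):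
  `|B′(Y)| ≤ 2^{d+2} K₁(d) B₀ e^{−(κ−κ₀−1) d_M(Y, mod Λᶜ)}`.

**Readings / divergences (declared).**  (i) *"connected component of Λᶜ connected to X"* (L2616) is read as "wall-component
of Λᶜ MEETING X" — the least choice for which `Y ∈ 𝒟_k(mod Λᶜ)`; Lemma 19 is proved for EVERY adjoining map `φ` with `X ⊆
φ X ⊆ X ∪ Λᶜ` (Part 4), so the alternative reading (components meeting or wall-adjacent to `X`) is covered as well.  (ii)
CONSTANTS explicit and not optimised: `𝒪(1) = 2^{d+2} K₁(d)` with `κ₀ ≥ κ₁(d)` the threshold of the cell's Lemma E.3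
(`HoleSummability.kappa₁`, `K₁`; print: *"κ₀, K₀ = 𝒪(1)"*); the hypothesis `κ₀ ≤ κ` (implicit in print) is displayed.  (iii)
The first line of (topaz) L2648 prints `𝒟_k(mod Λᶜ)` where the summand `d_M(X, mod Ωᶜ)` and the next line have `𝒟_k(mod
Ωᶜ)` — read as `Ωᶜ` (a located misprint, immaterial); the kernel proof extracts `e^{−(κ−κ₀) d_M(Y, mod Λᶜ)}` on the fibre `X →
Y` BEFORE enlarging the index set to `X ∩ (Y ∩ Λ) ≠ ∅`, which is what the claim L2636–2642 supports.  (iv) *"|Y ∩ Λ|_M ≤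
𝒪(1)(d_M(Y ∩ Λ) + 1) = 𝒪(1)(d_M(Y, mod Λᶜ) + 1)"* (L2658) is proved directly in the form `|Y ∩ Λ|_M ≤ 2^d(4 d_M(Y, mod Λᶜ) +
1)` from the graphs defining `d_M(Y, mod Λᶜ)` (no length `d_M` of the possibly disconnected `Y ∩ Λ` is introduced).  (v)
The conventions D-pv22.1 / D-pv22g2.1 of `torusTreeLen` / `torusTreeLenMod` (sup metric of [Dimock2013BalabanII] App. E,
connected polygonal graphs in place of trees, geometry in the universal cover, junk value 0 of the infima on empty
classes) and reading (iv) of `…ThreeSortedResummation` (`𝒟_k(mod ·)` component-free; equivalence with the printed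
component form = `HoleSummability.dMod_iff_components`) apply.  (vi) `B′` is defined relative to a finite family `𝒜` (Part
4); the printed `B′` is the case `𝒜 = polymersMod Ω Λ` (Part 5).

**What is NOT claimed.**  Nothing of [Dimock2013BalabanIII] §2.8 / §3 or [Dimock2013BalabanII] §3.13–3.18 beyond this
appendix (the terms `B^*`, `R^{*,(i)}`, `E^+` to which it is applied are not typed); no Bałaban quantity is touched
(TEMPLATE.md §4.3 row «D3 App. A/B/C» maps App. B only as «technical», Bałaban-side counterpart B14 §2/§3 boundary-term
conventions and B16 §1 (1.98)–(1.104), grade T, via §4.2 row «D2 §3.13»).  Value = the last unreproduced lemma of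
[Dimock2013BalabanIII]'s appendices made kernel over the cell's own polymer model, NOT summit progress (YM₄ on T⁴ /
infinite volume / mass gap are elsewhere and out of scope); NOT a statement about any Bałaban paper; NOT continuum; NOT
Clay.

Cell records: TEMPLATE.md §4.3 (row D3 App. A/B/C), §15.2 (kernel status); GAPS.md C-tmpl30-1; unit
`b2b-balaban-template` gen 30, journal CLAIM D3-APPB-RESUMMATION-KERNEL.  NEW leaf; imports
`…Dimock2011to13.HoleSummability` (this lineage, p184078; through it `…ThreeSortedResummation` p183502 and unit pv22's
`TreeLengthTorus`); namespace `…Dimock2011to13.ResummationOperation`; modifies nothing.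

**Version.**  v1.0.1 — DOCFIX fold (docstring-only; declarations, statements and proofs byte-identical to v1
p200514) of the outside cross-read b2b-balaban-beta-an3-g21 (journal XREAD VERDICT l.2759 on request l.2608: ok CONSISTENT
5∕5, DOCFIX 0, optional nits O1∕O2; GAPS C-beta-an3-53): O1 — `card_sdiff_le_torusTreeLenMod` now quotes print's full
chain *"|Y ∩ Λ|_M ≤ 𝒪(1)(d_M(Y ∩ Λ) + 1) = 𝒪(1)(d_M(Y, mod Λᶜ) + 1)"* (L2658) instead of joining its two ends; O2 — the
locator of [Dimock2013BalabanII] App. E Lemma E.1 (3) in `card_le_of_tCover_len` widened from «L6790–6822» to the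
statement L6790–6798 plus item (3)'s proof display through L6828.  v1 — p200514 (2026-08-19, commit 41c1a953bd15).
-/

noncomputable section

open Real Finset
open Literature.Probability.LatticeModels (rcomponent mem_rcomponent rcomponent_subset)
open Literature.MathematicalPhysics.QuantumFieldTheory.Balaban1983to89.TreeLength
open Literature.MathematicalPhysics.QuantumFieldTheory.Balaban1983to89.TreeLengthTorus
open Literature.MathematicalPhysics.QuantumFieldTheory.Dimock2011to13.ThreeSorted
open Literature.MathematicalPhysics.QuantumFieldTheory.Dimock2011to13.HoleSummability (compSet mem_of_dMod kappa₁ K₁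
  K₁_pos sum_exp_torusTreeLenMod_le)

namespace Literature.MathematicalPhysics.QuantumFieldTheory.Dimock2011to13.ResummationOperation

variable {d N : ℕ}

/-! ## Part 1. The map `X → Y`: adjoining the components of the new holes met by `X` -/

/-- **`X → Y`** — *"Every such X determines a Y ∈ 𝒟_k(mod Λᶜ) with Y ∩ Λ ≠ ∅ by taking the union with any connected
component of Λᶜ connected to X, written X → Y"*: with `Θ` the cubes of the new holes `Λᶜ`, `adjoin Θ X` is `X` together
with every wall-component of `Θ` met by `X` (the family `HoleSummability.compSet Θ X`; reading (i) of the module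
docstring). [cite: Dimock2013BalabanIII, App. B L2615–2616 (arXiv:1304.0705v1 TeX)] -/
def adjoin (Θ X : Finset (TPt d N)) : Finset (TPt d N) := X ∪ (compSet Θ X).biUnion id

/-- Membership in `adjoin Θ X`: a cube of `X`, or a cube of the `Θ`-component of a cube of `X ∩ Θ`.
[cite: Dimock2013BalabanIII, App. B L2615–2616 (arXiv:1304.0705v1 TeX)] -/
theorem mem_adjoin {Θ X : Finset (TPt d N)} {b : TPt d N} :
    b ∈ adjoin Θ X ↔ b ∈ X ∨ ∃ a ∈ X ∩ Θ, b ∈ rcomponent TAdj Θ a := by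
  unfold adjoin compSet
  simp only [Finset.mem_union, Finset.mem_biUnion, Finset.mem_image, id, exists_exists_and_eq_and]

/-- `X ⊆ Y` for `X → Y`. [cite: Dimock2013BalabanIII, App. B L2615–2616 (arXiv:1304.0705v1 TeX)] -/
theorem subset_adjoin (Θ X : Finset (TPt d N)) : X ⊆ adjoin Θ X := fun _ hb => mem_adjoin.2 (Or.inl hb)

/-- Only cubes of the holes are adjoined: `Y ⊆ X ∪ Λᶜ`. [cite: Dimock2013BalabanIII, App. B L2615–2616 (arXiv:1304.0705v1 TeX)] -/
theorem adjoin_subset_union (Θ X : Finset (TPt d N)) : adjoin Θ X ⊆ X ∪ Θ := by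
  intro b hb
  rcases mem_adjoin.1 hb with h | ⟨a, -, h⟩
  · exact Finset.mem_union_left _ h
  · exact Finset.mem_union_right _ (rcomponent_subset Θ a h)

/-- *"Y ∩ Λ = X ∩ Λ"* (L2641): outside the holes nothing changes, `adjoin Θ X ∖ Θ = X ∖ Θ`.
[cite: Dimock2013BalabanIII, App. B proof L2641–2642 (arXiv:1304.0705v1 TeX)] -/
theorem adjoin_sdiff (Θ X : Finset (TPt d N)) : adjoin Θ X \ Θ = X \ Θ := by
  ext b
  simp only [Finset.mem_sdiff]
  constructor
  · rintro ⟨hb, hbΘ⟩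
    rcases mem_adjoin.1 hb with h | ⟨a, -, h⟩
    · exact ⟨h, hbΘ⟩
    · exact absurd (rcomponent_subset Θ a h) hbΘ
  · rintro ⟨hb, hbΘ⟩
    exact ⟨subset_adjoin Θ X hb, hbΘ⟩

/-- **`Y ∈ 𝒟_k(mod Λᶜ)`** — the adjoined family contains, with any cube of a wall-component of `Θ`, the whole component.
[cite: Dimock2013BalabanIII, App. B L2615–2616 (arXiv:1304.0705v1 TeX); Dimock2013BalabanII, §3.3 L1680–1687
(arXiv:1212.5562v2 TeX)] -/
theorem dMod_adjoin (Θ X : Finset (TPt d N)) : DMod Θ (adjoin Θ X) := by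
  have key : ∀ a ∈ Θ, ∀ b ∈ Θ, TAdj a b → a ∈ adjoin Θ X → b ∈ adjoin Θ X := by
    intro a ha b hb hab h
    rcases mem_adjoin.1 h with hX | ⟨x, hx, hxa⟩
    · exact mem_adjoin.2 (Or.inr ⟨a, Finset.mem_inter.2 ⟨hX, ha⟩,
        mem_rcomponent.2 ⟨hb, Relation.ReflTransGen.single ⟨hab, ha, hb⟩⟩⟩)
    · exact mem_adjoin.2 (Or.inr ⟨x, hx, mem_rcomponent.2 ⟨hb, (mem_rcomponent.1 hxa).2.tail ⟨hab, ha, hb⟩⟩⟩)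
  intro a ha b hb hab
  exact ⟨key a ha b hb hab, key b hb a ha hab.symm⟩

/-- Chain-connectedness inside a family is symmetric (wall adjacency is). [folklore] -/
private theorem tLinked_symm {S : Finset (TPt d N)} {a b : TPt d N} (h : TLinked S a b) : TLinked S b a := by
  induction h with
  | refl => exact Relation.ReflTransGen.refl
  | tail _ hbc ih => exact Relation.ReflTransGen.head ⟨hbc.2.1, hbc.1, hbc.2.2.symm⟩ ih

/-- Chain-connectedness is monotone in the family. [folklore] -/
private theorem tLinked_mono {S S' : Finset (TPt d N)} (hS : S ⊆ S') {a b : TPt d N} (h : TLinked S a b) :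
    TLinked S' a b := by
  induction h with
  | refl => exact Relation.ReflTransGen.refl
  | tail _ hbc ih => exact ih.tail ⟨hS hbc.1, hS hbc.2.1, hbc.2.2⟩

/-- A wall-chain inside `Θ` from a cube of `X ∩ Θ` runs inside `adjoin Θ X`. [folklore] -/
private theorem tLinked_adjoin_of_chain {Θ X : Finset (TPt d N)} {a b : TPt d N} (ha : a ∈ X ∩ Θ)
    (h : Relation.ReflTransGen (fun x y => TAdj x y ∧ x ∈ Θ ∧ y ∈ Θ) a b) : TLinked (adjoin Θ X) a b := by
  induction h with
  | refl => exact Relation.ReflTransGen.refl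
  | @tail x y hax hxy ih =>
    refine ih.tail ⟨?_, ?_, hxy.1⟩
    · exact mem_adjoin.2 (Or.inr ⟨a, ha, mem_rcomponent.2 ⟨hxy.2.1, hax⟩⟩)
    · exact mem_adjoin.2 (Or.inr ⟨a, ha, mem_rcomponent.2 ⟨hxy.2.2, hax.tail hxy⟩⟩)

/-- **`Y` is a localization domain**: adjoining met wall-components of the holes to a torus-face-connected family keeps
it torus-face-connected. [cite: Dimock2013BalabanIII, App. B L2615–2616 (arXiv:1304.0705v1 TeX)] -/
theorem tFaceConnected_adjoin {Θ X : Finset (TPt d N)} (hX : TFaceConnected X) : TFaceConnected (adjoin Θ X) := by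
  -- every cube of `adjoin Θ X` is linked, inside it, to a cube of `X`
  have hlink : ∀ b ∈ adjoin Θ X, ∃ a ∈ X, TLinked (adjoin Θ X) a b := by
    intro b hb
    rcases mem_adjoin.1 hb with h | ⟨a, ha, hab⟩
    · exact ⟨b, h, Relation.ReflTransGen.refl⟩
    · exact ⟨a, (Finset.mem_inter.1 ha).1, tLinked_adjoin_of_chain ha (mem_rcomponent.1 hab).2⟩
  intro x hx y hy
  obtain ⟨a, ha, hax⟩ := hlink x hx
  obtain ⟨b, hb, hby⟩ := hlink y hy
  exact ((tLinked_symm hax).trans (tLinked_mono (subset_adjoin Θ X) (hX a ha b hb))).trans hby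

/-- `adjoin Θ X` is non-empty when `X` is. [cite: Dimock2013BalabanIII, App. B L2615–2616 (arXiv:1304.0705v1 TeX)] -/
theorem adjoin_nonempty {Θ X : Finset (TPt d N)} (hX : X.Nonempty) : (adjoin Θ X).Nonempty :=
  hX.mono (subset_adjoin Θ X)

/-- On `𝒟_k(mod Θ)` the map is the identity: a polymer with holes already contains every component of `Θ` it meets
(`HoleSummability.mem_of_dMod`), so `X → X`. [cite: Dimock2013BalabanII, §3.3 L1680–1687 (arXiv:1212.5562v2 TeX)] -/
theorem adjoin_eq_self_of_dMod {Θ X : Finset (TPt d N)} (h : DMod Θ X) : adjoin Θ X = X := by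
  refine Finset.Subset.antisymm (fun b hb => ?_) (subset_adjoin Θ X)
  rcases mem_adjoin.1 hb with hX | ⟨a, ha, hab⟩
  · exact hX
  · exact mem_of_dMod h (Finset.mem_inter.1 ha).1 hab

/-- … hence `X → Y` is a retraction onto `𝒟_k(mod Θ)`: `adjoin Θ (adjoin Θ X) = adjoin Θ X`.
[cite: Dimock2013BalabanIII, App. B L2615–2616 (arXiv:1304.0705v1 TeX)] -/
theorem adjoin_adjoin (Θ X : Finset (TPt d N)) : adjoin Θ (adjoin Θ X) = adjoin Θ X :=
  adjoin_eq_self_of_dMod (dMod_adjoin Θ X)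

/-! ## Part 2. The first claim: `d_M(Y, mod Λᶜ) ≤ d_M(X, mod Ωᶜ)` -/

section Claim

variable [NeZero N]

/-- **THE FIRST CLAIM** (L2636–2642) — *"let τ be a minimal tree joining the cubes in X ∩ Ω … Then τ is also a tree joining
the cubes in Y ∩ Λ since Y ∩ Λ = X ∩ Λ ⊂ X ∩ Ω. Hence M d_M(Y, mod Λᶜ) ≤ ℓ(τ)"*: for a localization domain `X`, old holes
`Θ₀ ⊆ Θ` (i.e. `Ω ⊇ Λ`) and ANY `Y ⊇ X` with `Y ∖ Θ ⊆ X`, `d_M(Y, mod Θ) ≤ d_M(X, mod Θ₀)` (near-minimal graphs in place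
of a minimal tree, convention D-pv22.1). [cite: Dimock2013BalabanIII, App. B Lemma 19 proof L2636–2642 (arXiv:1304.0705v1 TeX)] -/
theorem torusTreeLenMod_le_of_subset {X Y Θ₀ Θ : Finset (TPt d N)} (hX : X.Nonempty) (hc : TFaceConnected X)
    (hΘ : Θ₀ ⊆ Θ) (hXY : X ⊆ Y) (hYΘ : Y \ Θ ⊆ X) : torusTreeLenMod Y Θ ≤ torusTreeLenMod X Θ₀ := by
  rw [torusTreeLenMod_eq_coverLen, torusTreeLenMod_eq_coverLen]
  refine coverLen_mono hXY (fun b hb => ?_)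
    (exists_tCover_of_dom hX hc (Finset.Subset.refl X) Finset.sdiff_subset)
  have hb' := Finset.mem_sdiff.1 hb
  exact Finset.mem_sdiff.2 ⟨hYΘ hb, fun h0 => hb'.2 (hΘ h0)⟩

/-- The first claim for `Y = adjoin Θ X`: `d_M(Y, mod Λᶜ) ≤ d_M(X, mod Ωᶜ)`.
[cite: Dimock2013BalabanIII, App. B Lemma 19 proof L2636–2642 (arXiv:1304.0705v1 TeX)] -/
theorem torusTreeLenMod_adjoin_le {X Θ₀ Θ : Finset (TPt d N)} (hX : X.Nonempty) (hc : TFaceConnected X)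
    (hΘ : Θ₀ ⊆ Θ) : torusTreeLenMod (adjoin Θ X) Θ ≤ torusTreeLenMod X Θ₀ :=
  torusTreeLenMod_le_of_subset hX hc hΘ (subset_adjoin Θ X) (by rw [adjoin_sdiff]; exact Finset.sdiff_subset)

end Claim

/-! ## Part 3. The volume step: `|Y ∩ Λ|_M ≤ 2^d(4 d_M(Y, mod Λᶜ) + 1) ≤ 2^{d+2} e^{d_M(Y, mod Λᶜ)}` -/

/-- `|B| ≤ 2^d(4ℓ(T) + 1)` for a connected polygonal graph meeting a lift of every cube of `B` — choose one met lift per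
cube (distinct projections, so `|B|` distinct cubes of `ℤ^d`) and apply pv22's `TreeLength.card_le_of_sAdmissible_len`
(= the mechanism of [Dimock2013BalabanII] Lemma E.1 (3)). [cite: Dimock2013BalabanII, App. E Lemma E.1 (3), statement
L6790–6798, item (3) with its proof display through L6828 (arXiv:1212.5562v2 TeX)] -/
theorem card_le_of_tCover_len {S B : Finset (TPt d N)} {T : List (Seg d)} (hT : TCover S B T) :
    (B.card : ℝ) ≤ 2 ^ d * (4 * len T + 1) := by
  classical
  choose! f hfproj hfmeets using hT.meets
  have hinj : Set.InjOn f B := by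
    intro a ha b hb hab
    rw [← hfproj a ha, ← hfproj b hb, hab]
  have hcard : (B.image f).card = B.card := Finset.card_image_of_injOn hinj
  have hS : SAdmissible (B.image f) T := by
    refine ⟨hT.connected, ?_⟩
    intro y hy
    obtain ⟨a, ha, rfl⟩ := Finset.mem_image.1 hy
    exact hfmeets a ha
  have h := card_le_of_sAdmissible_len hS
  rw [hcard] at h
  exact h

/-- *"|Y ∩ Λ|_M ≤ 𝒪(1)(d_M(Y ∩ Λ) + 1) = 𝒪(1)(d_M(Y, mod Λᶜ) + 1)"* (L2658), explicit:
`|Y ∖ Θ| ≤ 2^d(4 d_M(Y, mod Θ) + 1)` whenever the class of graphs defining `d_M(Y, mod Θ)` is non-empty.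
[cite: Dimock2013BalabanIII, App. B Lemma 19 proof L2657–2659 (arXiv:1304.0705v1 TeX)] -/
theorem card_sdiff_le_torusTreeLenMod {Y Θ : Finset (TPt d N)} (hne : ∃ T, TCover Y (Y \ Θ) T) :
    ((Y \ Θ).card : ℝ) ≤ 2 ^ d * (4 * torusTreeLenMod Y Θ + 1) := by
  have h2d : (0 : ℝ) < 2 ^ d := by positivity
  have h : (((Y \ Θ).card : ℝ) / 2 ^ d - 1) / 4 ≤ torusTreeLenMod Y Θ := by
    rw [torusTreeLenMod_eq_coverLen]
    refine le_coverLen hne fun T hT => ?_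
    have := card_le_of_tCover_len hT
    rw [div_le_iff₀ (by norm_num : (0 : ℝ) < 4), sub_le_iff_le_add, div_le_iff₀ h2d]
    linarith
  rw [div_le_iff₀ (by norm_num : (0 : ℝ) < 4), sub_le_iff_le_add, div_le_iff₀ h2d] at h
  linarith

/-- … *"≤ 𝒪(1) e^{d_M(Y, mod Λᶜ)}"* (L2658), explicit: `|Y ∖ Θ| ≤ 2^{d+2} e^{d_M(Y, mod Θ)}` (by `4t + 1 ≤ 4e^t`).
[cite: Dimock2013BalabanIII, App. B Lemma 19 proof L2657–2659 (arXiv:1304.0705v1 TeX)] -/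
theorem card_sdiff_le_exp {Y Θ : Finset (TPt d N)} (hne : ∃ T, TCover Y (Y \ Θ) T) :
    ((Y \ Θ).card : ℝ) ≤ 2 ^ (d + 2) * exp (torusTreeLenMod Y Θ) := by
  have h := card_sdiff_le_torusTreeLenMod hne
  have he := Real.add_one_le_exp (torusTreeLenMod Y Θ)
  have h2d : (0 : ℝ) ≤ 2 ^ d := by positivity
  calc ((Y \ Θ).card : ℝ) ≤ 2 ^ d * (4 * torusTreeLenMod Y Θ + 1) := h
    _ ≤ 2 ^ d * (4 * exp (torusTreeLenMod Y Θ)) := mul_le_mul_of_nonneg_left (by linarith) h2d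
    _ = 2 ^ (d + 2) * exp (torusTreeLenMod Y Θ) := by rw [pow_add]; ring

/-! ## Part 4. `B′`, the regrouping identity and Lemma 19 (opal) for a finite family and an adjoining map -/

section Diamond

variable (𝒜 : Finset (Finset (TPt d N))) (φ : Finset (TPt d N) → Finset (TPt d N)) (B : Finset (TPt d N) → ℝ)

/-- **`B′(Y) = Σ_{X ∈ 𝒟_k(mod Ωᶜ), X ∩ Λ ≠ ∅, X → Y} B(X)`** relative to a finite family `𝒜` of such `X` and an adjoining
map `φ` (`X → φ X`). [cite: Dimock2013BalabanIII, App. B L2617–2620 (arXiv:1304.0705v1 TeX)] -/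
def Bprime (Y : Finset (TPt d N)) : ℝ := ∑ X ∈ 𝒜 with φ X = Y, B X

/-- **THE REGROUPING IDENTITY** `Σ_X B(X) = Σ_Y B′(Y)` (L2622–2624) over any finite `ℬ` receiving `φ(𝒜)` — a fibrewise
sum. [cite: Dimock2013BalabanIII, App. B L2621–2624 (arXiv:1304.0705v1 TeX)] -/
theorem sum_eq_sum_Bprime {ℬ : Finset (Finset (TPt d N))} (hmaps : ∀ X ∈ 𝒜, φ X ∈ ℬ) :
    ∑ X ∈ 𝒜, B X = ∑ Y ∈ ℬ, Bprime 𝒜 φ B Y := by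
  unfold Bprime
  exact (Finset.sum_fiberwise_of_maps_to hmaps B).symm

variable [NeZero N]

/-- **LEMMA 19 (diamond), eq. (opal)** — *"|B′(Y)| ≤ 𝒪(1) B₀ e^{−(κ−κ₀−1) d_M(Y, mod Λᶜ)}"* — for a finite family `𝒜` of
polymers `X ∈ 𝒟_k(mod Θ₀)` meeting `Λ = Θᶜ`, old holes `Θ₀ ⊆ Θ` (`Ω ⊇ Λ`), ANY adjoining map `φ` with `X ⊆ φ X`, `φ X ∖ Θ
⊆ X`, weights `|B(X)| ≤ B₀ e^{−κ d_M(X, mod Θ₀)}` (`B₀ ≥ 0`) and `κ₁(d) ≤ κ₀ ≤ κ`: for EVERY `Y`,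
`|B′(Y)| ≤ 2^{d+2} K₁(d) B₀ e^{−(κ−κ₀−1) d_M(Y, mod Θ)}`.  Proof = the printed chain (topaz) with Lemma E.3 of part II
(`HoleSummability.sum_exp_torusTreeLenMod_le`) and the volume step. [cite: Dimock2013BalabanIII, App. B Lemma 19 (opal)
L2627–2631, proof L2635–2659 (arXiv:1304.0705v1 TeX)] -/
theorem abs_Bprime_le {Θ₀ Θ : Finset (TPt d N)} (hΘ : Θ₀ ⊆ Θ)
    (h𝒜 : ∀ X ∈ 𝒜, X.Nonempty ∧ TFaceConnected X ∧ DMod Θ₀ X ∧ (X \ Θ).Nonempty)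
    (hφ : ∀ X ∈ 𝒜, X ⊆ φ X ∧ φ X \ Θ ⊆ X) {B₀ κ κ₀ : ℝ} (hB₀ : 0 ≤ B₀) (hκ₀ : kappa₁ d ≤ κ₀) (hκ : κ₀ ≤ κ)
    (hB : ∀ X ∈ 𝒜, |B X| ≤ B₀ * exp (-κ * torusTreeLenMod X Θ₀)) (Y : Finset (TPt d N)) :
    |Bprime 𝒜 φ B Y| ≤ 2 ^ (d + 2) * K₁ d * B₀ * exp (-(κ - κ₀ - 1) * torusTreeLenMod Y Θ) := by
  set F : Finset (Finset (TPt d N)) := 𝒜.filter (fun X => φ X = Y) with hF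
  set t : ℝ := torusTreeLenMod Y Θ with ht
  have hBp : Bprime 𝒜 φ B Y = ∑ X ∈ F, B X := rfl
  have hK₁ : 0 ≤ K₁ d := (K₁_pos d).le
  by_cases hFe : F = ∅
  · -- empty fibre: `B′(Y) = 0`
    rw [hBp, hFe, Finset.sum_empty, abs_zero]
    positivity
  obtain ⟨X₀, hX₀⟩ := Finset.nonempty_iff_ne_empty.2 hFe
  have hX₀𝒜 : X₀ ∈ 𝒜 := (Finset.mem_filter.1 hX₀).1
  have hX₀Y : φ X₀ = Y := (Finset.mem_filter.1 hX₀).2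
  obtain ⟨hX₀ne, hX₀c, -, -⟩ := h𝒜 X₀ hX₀𝒜
  have hsub₀ : X₀ ⊆ Y := hX₀Y ▸ (hφ X₀ hX₀𝒜).1
  have hsd₀ : Y \ Θ ⊆ X₀ := hX₀Y ▸ (hφ X₀ hX₀𝒜).2
  -- the class of graphs for `(Y, Y ∖ Θ)` is non-empty: a graph of the localization domain `X₀ ⊆ Y` serves
  have hne : ∃ T, TCover Y (Y \ Θ) T := exists_tCover_of_dom hX₀ne hX₀c hsub₀ hsd₀
  -- termwise: `|B(X)| ≤ B₀ e^{−(κ−κ₀) d(Y)} e^{−κ₀ d(X)}` on the fibre (the first claim)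
  have hterm : ∀ X ∈ F, |B X| ≤ B₀ * exp (-(κ - κ₀) * t) * exp (-κ₀ * torusTreeLenMod X Θ₀) := by
    intro X hX
    have hX𝒜 : X ∈ 𝒜 := (Finset.mem_filter.1 hX).1
    have hXY : φ X = Y := (Finset.mem_filter.1 hX).2
    obtain ⟨hXne, hXc, -, -⟩ := h𝒜 X hX𝒜
    have hle : t ≤ torusTreeLenMod X Θ₀ :=
      torusTreeLenMod_le_of_subset hXne hXc hΘ (hXY ▸ (hφ X hX𝒜).1) (hXY ▸ (hφ X hX𝒜).2)
    refine (hB X hX𝒜).trans ?_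
    rw [mul_assoc, ← Real.exp_add]
    refine mul_le_mul_of_nonneg_left (Real.exp_le_exp.2 ?_) hB₀
    nlinarith [mul_nonneg (sub_nonneg.2 hκ) (sub_nonneg.2 hle)]
  -- the fibre is covered by the families `{X ∈ 𝒜 : X ∋ □}`, `□ ∈ Y ∖ Θ`
  have hcov : ∀ X ∈ F, ∃ c ∈ Y \ Θ, X ∈ 𝒜.filter (fun X => c ∈ X) := by
    intro X hX
    have hX𝒜 : X ∈ 𝒜 := (Finset.mem_filter.1 hX).1
    have hXY : φ X = Y := (Finset.mem_filter.1 hX).2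
    obtain ⟨-, -, -, ⟨c, hc⟩⟩ := h𝒜 X hX𝒜
    have hc' := Finset.mem_sdiff.1 hc
    refine ⟨c, Finset.mem_sdiff.2 ⟨?_, hc'.2⟩, Finset.mem_filter.2 ⟨hX𝒜, hc'.1⟩⟩
    exact (hXY ▸ (hφ X hX𝒜).1) hc'.1
  -- Lemma E.3 of part II through each cube `□ ∈ Y ∖ Θ` (*"Since Y ∩ Λ ⊂ Ω"*: `□ ∉ Θ₀`)
  have hE3 : ∀ c ∈ Y \ Θ, ∑ X ∈ 𝒜.filter (fun X => c ∈ X), exp (-κ₀ * torusTreeLenMod X Θ₀) ≤ K₁ d := by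
    intro c hc
    have hcΘ₀ : c ∉ Θ₀ := fun h0 => (Finset.mem_sdiff.1 hc).2 (hΘ h0)
    refine sum_exp_torusTreeLenMod_le Θ₀ hcΘ₀ _ (fun X hX => ?_) hκ₀
    obtain ⟨hX𝒜, hcX⟩ := Finset.mem_filter.1 hX
    obtain ⟨h1, h2, h3, -⟩ := h𝒜 X hX𝒜
    exact ⟨h1, h2, hcX, h3⟩
  have hsum : ∑ X ∈ F, exp (-κ₀ * torusTreeLenMod X Θ₀) ≤ ((Y \ Θ).card : ℝ) * K₁ d := by
    calc ∑ X ∈ F, exp (-κ₀ * torusTreeLenMod X Θ₀)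
        ≤ ∑ c ∈ Y \ Θ, ∑ X ∈ 𝒜.filter (fun X => c ∈ X), exp (-κ₀ * torusTreeLenMod X Θ₀) :=
          sum_le_sum_sum_of_cover F (Y \ Θ) (fun c => 𝒜.filter (fun X => c ∈ X))
            (fun X => exp (-κ₀ * torusTreeLenMod X Θ₀)) (fun X => (Real.exp_pos _).le) hcov
      _ ≤ ∑ _c ∈ Y \ Θ, K₁ d := Finset.sum_le_sum hE3
      _ = ((Y \ Θ).card : ℝ) * K₁ d := by rw [Finset.sum_const, nsmul_eq_mul]
  -- the volume step
  have hvol : ((Y \ Θ).card : ℝ) ≤ 2 ^ (d + 2) * exp t := card_sdiff_le_exp hne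
  have hexp : exp (-(κ - κ₀) * t) * exp t = exp (-(κ - κ₀ - 1) * t) := by
    rw [← Real.exp_add]
    congr 1
    ring
  calc |Bprime 𝒜 φ B Y| = |∑ X ∈ F, B X| := by rw [hBp]
    _ ≤ ∑ X ∈ F, |B X| := Finset.abs_sum_le_sum_abs _ _
    _ ≤ ∑ X ∈ F, B₀ * exp (-(κ - κ₀) * t) * exp (-κ₀ * torusTreeLenMod X Θ₀) := Finset.sum_le_sum hterm
    _ = B₀ * exp (-(κ - κ₀) * t) * ∑ X ∈ F, exp (-κ₀ * torusTreeLenMod X Θ₀) := by rw [Finset.mul_sum]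
    _ ≤ B₀ * exp (-(κ - κ₀) * t) * (((Y \ Θ).card : ℝ) * K₁ d) :=
        mul_le_mul_of_nonneg_left hsum (by positivity)
    _ ≤ B₀ * exp (-(κ - κ₀) * t) * (2 ^ (d + 2) * exp t * K₁ d) :=
        mul_le_mul_of_nonneg_left (mul_le_mul_of_nonneg_right hvol hK₁) (by positivity)
    _ = 2 ^ (d + 2) * K₁ d * B₀ * (exp (-(κ - κ₀) * t) * exp t) := by ring
    _ = 2 ^ (d + 2) * K₁ d * B₀ * exp (-(κ - κ₀ - 1) * t) := by rw [hexp]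

/-- Lemma 19 for the printed map `X → Y = adjoin Θ X`. [cite: Dimock2013BalabanIII, App. B Lemma 19 (opal) L2627–2631
(arXiv:1304.0705v1 TeX)] -/
theorem abs_Bprime_adjoin_le {Θ₀ Θ : Finset (TPt d N)} (hΘ : Θ₀ ⊆ Θ)
    (h𝒜 : ∀ X ∈ 𝒜, X.Nonempty ∧ TFaceConnected X ∧ DMod Θ₀ X ∧ (X \ Θ).Nonempty)
    {B₀ κ κ₀ : ℝ} (hB₀ : 0 ≤ B₀) (hκ₀ : kappa₁ d ≤ κ₀) (hκ : κ₀ ≤ κ)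
    (hB : ∀ X ∈ 𝒜, |B X| ≤ B₀ * exp (-κ * torusTreeLenMod X Θ₀)) (Y : Finset (TPt d N)) :
    |Bprime 𝒜 (adjoin Θ) B Y| ≤ 2 ^ (d + 2) * K₁ d * B₀ * exp (-(κ - κ₀ - 1) * torusTreeLenMod Y Θ) :=
  abs_Bprime_le 𝒜 (adjoin Θ) B hΘ h𝒜
    (fun X _ => ⟨subset_adjoin Θ X, by rw [adjoin_sdiff]; exact Finset.sdiff_subset⟩) hB₀ hκ₀ hκ hB Y

end Diamond

/-! ## Part 5. The printed form: `Ω ⊇ Λ`, the full index sets `𝒟_k(mod Ωᶜ) ∩ {X ∩ Λ ≠ ∅}` -/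

section Printed

variable [NeZero N]

/-- The printed index set `{X ∈ 𝒟_k(mod Ωᶜ) : X ∩ Λ ≠ ∅}` — ALL localization domains of the torus in `𝒟_k(mod Ωᶜ)`
meeting `Λ`. [cite: Dimock2013BalabanIII, App. B L2605–2608 (arXiv:1304.0705v1 TeX)] -/
def polymersMod (Ω Λ : Finset (TPt d N)) : Finset (Finset (TPt d N)) := by
  classical exact Finset.univ.filter fun X => X.Nonempty ∧ TFaceConnected X ∧ DMod Ωᶜ X ∧ (X ∩ Λ).Nonempty

/-- Membership in `polymersMod Ω Λ`. [cite: Dimock2013BalabanIII, App. B L2605–2608 (arXiv:1304.0705v1 TeX)] -/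
theorem mem_polymersMod {Ω Λ X : Finset (TPt d N)} :
    X ∈ polymersMod Ω Λ ↔ X.Nonempty ∧ TFaceConnected X ∧ DMod Ωᶜ X ∧ (X ∩ Λ).Nonempty := by
  classical
  unfold polymersMod
  rw [Finset.mem_filter]
  simp only [Finset.mem_univ, true_and]

/-- `X ∖ Λᶜ = X ∩ Λ`. [folklore] -/
private theorem sdiff_compl_eq_inter (X Λ : Finset (TPt d N)) : X \ Λᶜ = X ∩ Λ := by
  ext b
  simp only [Finset.mem_sdiff, Finset.mem_compl, not_not, Finset.mem_inter]

/-- *"Every such X determines a Y ∈ 𝒟_k(mod Λᶜ) with Y ∩ Λ ≠ ∅"*: `adjoin Λᶜ` maps `{X ∈ 𝒟_k(mod Ωᶜ) : X ∩ Λ ≠ ∅}` into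
`{Y ∈ 𝒟_k(mod Λᶜ) : Y ∩ Λ ≠ ∅}` (no hypothesis on `Ω` is needed for this). [cite: Dimock2013BalabanIII, App. B L2615–2616
(arXiv:1304.0705v1 TeX)] -/
theorem adjoin_mem_polymersMod {Ω Λ X : Finset (TPt d N)} (hX : X ∈ polymersMod Ω Λ) :
    adjoin Λᶜ X ∈ polymersMod Λ Λ := by
  obtain ⟨hne, hc, -, hΛ⟩ := mem_polymersMod.1 hX
  exact mem_polymersMod.2 ⟨adjoin_nonempty hne, tFaceConnected_adjoin hc, dMod_adjoin Λᶜ X,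
    hΛ.mono (Finset.inter_subset_inter (subset_adjoin Λᶜ X) (Finset.Subset.refl Λ))⟩

/-- **THE PRINTED IDENTITY** (L2622–2624): `Σ_{X ∈ 𝒟_k(mod Ωᶜ), X ∩ Λ ≠ ∅} B(X) = Σ_{Y ∈ 𝒟_k(mod Λᶜ), Y ∩ Λ ≠ ∅} B′(Y)` with
`B′(Y) = Σ_{X → Y} B(X)` (`Bprime (polymersMod Ω Λ) (adjoin Λᶜ) B`). [cite: Dimock2013BalabanIII, App. B L2617–2624
(arXiv:1304.0705v1 TeX)] -/
theorem resummation_eq (Ω Λ : Finset (TPt d N)) (B : Finset (TPt d N) → ℝ) :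
    ∑ X ∈ polymersMod Ω Λ, B X = ∑ Y ∈ polymersMod Λ Λ, Bprime (polymersMod Ω Λ) (adjoin Λᶜ) B Y :=
  sum_eq_sum_Bprime _ _ B fun _ hX => adjoin_mem_polymersMod hX

/-- **LEMMA 19 (diamond) AS PRINTED** ([Dimock2013BalabanIII] App. B, eq. (opal)): *"Suppose Ω, Λ are unions of M cubes with
Λ ⊂ Ω, and … |B(X)| ≤ B₀ e^{−κ d_M(X, mod Ωᶜ)} … Then |B′(Y)| ≤ 𝒪(1) B₀ e^{−(κ−κ₀−1) d_M(Y, mod Λᶜ)}"* — on the torus polymer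
model, for every `Y`, with `𝒪(1) = 2^{d+2} K₁(d)`, `κ₁(d) ≤ κ₀ ≤ κ`, `B₀ ≥ 0`. [cite: Dimock2013BalabanIII, App. B Lemma 19
(opal) L2627–2631, proof L2635–2659 (arXiv:1304.0705v1 TeX)] -/
theorem lemma19 {Ω Λ : Finset (TPt d N)} (hΛΩ : Λ ⊆ Ω) (B : Finset (TPt d N) → ℝ) {B₀ κ κ₀ : ℝ} (hB₀ : 0 ≤ B₀)
    (hκ₀ : kappa₁ d ≤ κ₀) (hκ : κ₀ ≤ κ) (hB : ∀ X ∈ polymersMod Ω Λ, |B X| ≤ B₀ * exp (-κ * torusTreeLenMod X Ωᶜ))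
    (Y : Finset (TPt d N)) :
    |Bprime (polymersMod Ω Λ) (adjoin Λᶜ) B Y|
      ≤ 2 ^ (d + 2) * K₁ d * B₀ * exp (-(κ - κ₀ - 1) * torusTreeLenMod Y Λᶜ) := by
  refine abs_Bprime_adjoin_le (polymersMod Ω Λ) B (Finset.compl_subset_compl.2 hΛΩ) (fun X hX => ?_) hB₀ hκ₀ hκ hB Y
  obtain ⟨h1, h2, h3, h4⟩ := mem_polymersMod.1 hX
  exact ⟨h1, h2, h3, by rwa [sdiff_compl_eq_inter]⟩

end Printed

/-! ## Part 6. Non-vacuity -/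

/-- On the one-dimensional torus with three cubes `0, 1, 2` and holes `Θ = {1, 2}` (one wall-component), the polymer `X =
{0, 1}` meets `Θ`, and `X → Y` adjoins the whole component: the cube `2` belongs to `adjoin Θ X`. -/
example :
    (fun _ => (2 : ZMod 3) : TPt 1 3) ∈
      adjoin ({fun _ => (1 : ZMod 3), fun _ => (2 : ZMod 3)} : Finset (TPt 1 3))
        {fun _ => (0 : ZMod 3), fun _ => (1 : ZMod 3)} := by
  refine mem_adjoin.2 (Or.inr ⟨fun _ => (1 : ZMod 3), by decide, mem_rcomponent.2 ⟨by decide, ?_⟩⟩)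
  exact Relation.ReflTransGen.single ⟨⟨0, Or.inl (by decide)⟩, by decide, by decide⟩

/-- … and `X → Y` is the identity on a polymer already in `𝒟_k(mod Θ)`, e.g. one containing all the holes. -/
example (Θ X : Finset (TPt d N)) (h : Θ ⊆ X) : adjoin Θ X = X := adjoin_eq_self_of_dMod (dMod_of_subset h)

end Literature.MathematicalPhysics.QuantumFieldTheory.Dimock2011to13.ResummationOperation
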